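/-
Copyright: the b2b-balaban T⁴-continuum CRUX team, row NE7b OWNER lineage `t4-ne7b-p1` (gen 140). Project licence.
-/
import Summits.QuantumFields.BalabanUV.T4Continuum.Spine.NE7b.SupWhitenedThirdCumulantRaw
import Summits.QuantumFields.BalabanUV.T4Continuum.Spine.NE7b.SupCrossWeightedCovarianceDecay
import Summits.QuantumFields.BalabanUV.T4Continuum.Spine.NE7b.SupThirdCumulantTreeDecay

/-!
# THE THIRD-CUMULANT KERNEL LETTER OF THE FLUCTUATION STEP, GENERAL `Γ = AAᵀ` (SCOPING (d11)(4) — the cumulant piece of the third-order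
# kernel letter, ASSEMBLED): for the block class tilted against `N(0,AAᵀ)` in whitened coordinates, with Dobrushin's matrix `C = HA∕(1−lamA)`
# (off the diagonal) satisfying the WEIGHTED smallness `Σ_wC_{xw}θ_{xw} ≤ γθ < 1`, `Σ_xC_{xw}θ_{xw} ≤ γθ′ < 1` for a submultiplicative weight
# `θ ≥ 1` on the sampler index, the observables' weighted profiles `Σ_w a^v_wσ_{vw} ≤ αθ`, `a^v_wσ_{vw} ≤ βθ` for a cross weight `σ`
# (`σ_{xw} ≤ σ_{xz}θ_{zw}`), and a base weight `ρ ≥ 1` on the field sites (symmetric, submultiplicative, `ρ_{xy}⁸ ≤ σ_{xw}σ_{yw}`) with row letter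
# `Σ_yρ_{xy}⁻¹ ≤ S`:
#   `Σ_y Σ_z |E_ν(F_x − E F_x)(F_y − E F_y)(F_z − E F_z)| ≤ 4·√(m₄·K)·S²`,
#   `m₄ = 5κ₂⁴γ_op²∕(1−λγ_op)²`,  `K = αθ·(1−γθ)⁻¹·(βθ·(1−γθ′)⁻¹)∕(1−lamA)`
# — UNIFORM IN THE BACKGROUND AND THE VOLUME: (467) at the three distinguished vertices, (466)'s decay of `B`, (463)'s tree lemma and double
# sum (row NE7b, node U5c; (448), (453), (462), (463), (466), (467) BY NAME; [folklore])

Cell `pub-balaban`, sub-cell `t4`, spine estimate NE7b (`T4WeightBudget.RelWeightBound`; the cell's OWN estimate — NOT PRINTED in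
[Bałaban 1983–89], NOT PROVED).  Crux-route work under `Spine/NE7b/` by the row OWNER (`t4-ne7b-p1` gen 140, file (468)) under FREEZE
(0)'s crux-prover clause; NOTHING of Bałaban's is named as a Lean object, valued or asserted; no `T4Continuum/Support` leaf typed; no
`def`, no notation; zero `sorry`.  Imports (BY NAME): the OWNER's (467) `…SupWhitenedThirdCumulantRaw` (`whitened_third_cumulant_raw`),
(466) `…SupCrossWeightedCovarianceDecay` (`cross_bilinear_decay`; through it (462) `neumann_weighted_colsum_le`, (453)
`neumann_weighted_rowsum_le`, `rowsum_le_weighted`, (448) `neumann_nonneg`, `neumann_dominates`), (463) `…SupThirdCumulantTreeDecay`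
(`distinguished_bound`, `third_kernel_letter`).

WHAT IS PROVED ([folklore]): **`whitened_third_cumulant_kernel_letter`** (the display, in the whitened Gibbs format on `ℝ^κ`).

HONEST (what this is NOT).  The CUMULANT piece of `∂³W`'s kernel letter; the average piece `⟨U‴⟩` (row sums preserved, (437)'s pattern) and
the three `Cov(U″,U′)` pieces (two-point, (457)+(466)) and the cumulant FORM of `∂³W` for a general `Γ` ((424)∕(425) restated with `hΓ`)
are the successor's, as is the instantiation of the weighted letters `γθ, γθ′, αθ, βθ, S` from the geometry of `A`, `Hk` and `e^{μd}`;
orders four and five NOT typed.  Scalar skeleton ((A3), NC-NE7b-α UNRULED); nothing of Bałaban's asserted.  BY-NAME EFFECT ON THE WALL: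
NONE.  NE7b NOT PRINTED ∕ NOT PROVED; spine PROVED 0∕9; rung (B)+1 — the programme's measures remain FINITE-torus statements; NOT the mass
gap, NOT Clay.  HONEST DEPENDENCY: continuum YM on T⁴ ⇐ BetaPertH ∧ nine spine estimates (0∕9 proved); BetaPertH ⇐ (D1) ∧ (D4) ∧
CAP+tail; G-an2-4 gates asym, D1 and NE2∕3∕4.
-/

set_option autoImplicit false
set_option maxSynthPendingDepth 2

noncomputable section

namespace Summit.QuantumFields.BalabanUV.T4Continuum.NE7b.SupWhitenedThirdCumulantKernelLetter

open MeasureTheory ProbabilityTheory Real Set Function Finset Matrix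
open scoped BigOperators
open Literature.Probability.Distributions (matrixCLM)
open SupWhitenedThirdCumulantRaw (whitened_third_cumulant_raw)
open SupCrossWeightedCovarianceDecay (cross_bilinear_decay)
open SupWeightedCovarianceDecay (neumann_weighted_colsum_le)
open SupDobrushinWeightedNeumann (neumann_weighted_rowsum_le rowsum_le_weighted)
open SupDobrushinNeumannMatrix (neumann_nonneg neumann_dominates)
open SupThirdCumulantTreeDecay (distinguished_bound third_kernel_letter)
open SupWhitenedFirstOrderLetters (whitened_cross_nonneg whitened_obs_nonneg)

variable {ι κ : Type} [Fintype ι] [DecidableEq ι] [Fintype κ] [DecidableEq κ]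

variable {U : EuclideanSpace ℝ ι → ℝ} {U' : EuclideanSpace ℝ ι → EuclideanSpace ℝ ι →L[ℝ] ℝ}
  {U'' : EuclideanSpace ℝ ι → EuclideanSpace ℝ ι →L[ℝ] EuclideanSpace ℝ ι →L[ℝ] ℝ} {Hk : ι → ι → ℝ} {A : Matrix ι κ ℝ}
  {ψ : EuclideanSpace ℝ ι} {γop κ₀ κ₁ κ₂ a τ δ θp lam lamA γθ γθ' αθ βθ S : ℝ} {θ : κ → κ → ℝ} {σ : ι → κ → ℝ} {ρ : ι → ι → ℝ}

/-- **THE THIRD-CUMULANT KERNEL LETTER, GENERAL `Γ = AAᵀ`**: under the block class letters, the road's operator letter with the two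
regulators, the secant letter `λ` (`λγ_op < 1`), the majorant `Hk ≥ 0`, the diagonal letter `lamA < 1`, the weighted smallness of the whitened
Dobrushin matrix (rows `≤ γθ < 1`, columns `≤ γθ′ < 1` against a submultiplicative `θ ≥ 1`), the weighted profiles of the observables against a
compatible cross weight `σ ≥ 0`, and a symmetric submultiplicative base weight `ρ ≥ 1` with `ρ⁸ ≤ σσ` and `Σ_yρ_{xy}⁻¹ ≤ S`:
`Σ_y Σ_z |E_ν(F_x − E F_x)(F_y − E F_y)(F_z − E F_z)| ≤ 4√(m₄K)·S²`. [folklore] -/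
theorem whitened_third_cumulant_kernel_letter [Nonempty κ] (hΓop : (γop • (1 : Matrix ι ι ℝ) - A * Aᵀ).PosSemidef) (Y : Finset ι)
    (hUd : ∀ φ : EuclideanSpace ℝ ι, HasFDerivAt U (U' φ) φ) (hU'd : ∀ φ : EuclideanSpace ℝ ι, HasFDerivAt U' (U'' φ) φ)
    (hU''c : Continuous U'') (hκ₀ : 0 ≤ κ₀) (hκ₁ : 0 ≤ κ₁) (ha : 0 ≤ a) (hτ : 0 < τ) (hδ : 0 < δ) (hθ0 : 0 < θp) (hθ1 : θp < 1)
    (hκθ : (2 * κ₀ * (1 + τ) + 4 * δ) * γop ≤ θp) (hκθw : 2 * κ₀ * (1 + τ) * γop + 4 * δ ≤ θp)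
    (hstab : ∀ φ : EuclideanSpace ℝ ι, -(κ₀ * ∑ x ∈ Y, φ x ^ 2) ≤ U φ)
    (hU'b : ∀ φ : EuclideanSpace ℝ ι, ‖U' φ‖ ≤ κ₁ * (a + ∑ x ∈ Y, φ x ^ 2)) (hU''b : ∀ φ : EuclideanSpace ℝ ι, ‖U'' φ‖ ≤ κ₂) (hlam : 0 ≤ lam)
    (hUsec : ∀ s : ℝ, 0 ≤ s → s ≤ 1 → ∀ a b : EuclideanSpace ℝ ι,
      U ((1 - s) • a + s • b) - lam / 2 * (s * (1 - s)) * ∑ i, (a i - b i) ^ 2 ≤ (1 - s) * U a + s * U b)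
    (hρg : lam * γop < 1)
    (hHk : ∀ (φ : EuclideanSpace ℝ ι) (x z : ι), |U'' φ (EuclideanSpace.single z (1 : ℝ)) (EuclideanSpace.single x (1 : ℝ))| ≤ Hk x z)
    (hHk0 : ∀ v u, 0 ≤ Hk v u) (ψ : EuclideanSpace ℝ ι) (hlamA : ∀ x : κ, ∑ u, ∑ v, |A u x| * |A v x| * Hk v u ≤ lamA) (hlamA1 : lamA < 1)
    -- the weights
    (hθw1 : ∀ x z, 1 ≤ θ x z) (hθdiag : ∀ x, θ x x = 1) (hθmul : ∀ x y z, θ x z ≤ θ x y * θ y z)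
    (hσ0 : ∀ x w, 0 ≤ σ x w) (hσθ : ∀ x z w, σ x w ≤ σ x z * θ z w)
    (hρ1 : ∀ x y, 1 ≤ ρ x y) (hρsymm : ∀ x y, ρ x y = ρ y x) (hρmul : ∀ x y z, ρ x z ≤ ρ x y * ρ y z) (hρσ : ∀ x y w, ρ x y ^ 8 ≤ σ x w * σ y w)
    -- the weighted letters
    (hCθ : ∀ x : κ, ∑ w, (if w = x then 0 else ∑ u, ∑ v, |A u w| * |A v x| * Hk v u) / (1 - lamA) * θ x w ≤ γθ) (hγθ1 : γθ < 1)
    (hCθc : ∀ w : κ, ∑ x, (if w = x then 0 else ∑ u, ∑ v, |A u w| * |A v x| * Hk v u) / (1 - lamA) * θ x w ≤ γθ') (hγθ'1 : γθ' < 1)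
    (haσ : ∀ v : ι, ∑ w, (∑ u, |A u w| * Hk v u) * σ v w ≤ αθ) (hβ : 0 ≤ βθ) (haσ' : ∀ (v : ι) (w : κ), (∑ u, |A u w| * Hk v u) * σ v w ≤ βθ)
    (x : ι) (hS : ∑ y, 1 / ρ x y ≤ S) :
    ∑ y, ∑ z, |∫ w, (U' (matrixCLM A (WithLp.toLp 2 w) + ψ) (EuclideanSpace.single x (1 : ℝ)) -
            ∫ w', U' (matrixCLM A (WithLp.toLp 2 w') + ψ) (EuclideanSpace.single x (1 : ℝ))
              ∂((volume : Measure (κ → ℝ)).tilted fun z => -(1 / 2 * (z ⬝ᵥ z) + U (matrixCLM A (WithLp.toLp 2 z) + ψ)))) *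
          (U' (matrixCLM A (WithLp.toLp 2 w) + ψ) (EuclideanSpace.single y (1 : ℝ)) -
            ∫ w', U' (matrixCLM A (WithLp.toLp 2 w') + ψ) (EuclideanSpace.single y (1 : ℝ))
              ∂((volume : Measure (κ → ℝ)).tilted fun z => -(1 / 2 * (z ⬝ᵥ z) + U (matrixCLM A (WithLp.toLp 2 z) + ψ)))) *
          (U' (matrixCLM A (WithLp.toLp 2 w) + ψ) (EuclideanSpace.single z (1 : ℝ)) -
            ∫ w', U' (matrixCLM A (WithLp.toLp 2 w') + ψ) (EuclideanSpace.single z (1 : ℝ))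
              ∂((volume : Measure (κ → ℝ)).tilted fun z => -(1 / 2 * (z ⬝ᵥ z) + U (matrixCLM A (WithLp.toLp 2 z) + ψ))))
        ∂((volume : Measure (κ → ℝ)).tilted fun z => -(1 / 2 * (z ⬝ᵥ z) + U (matrixCLM A (WithLp.toLp 2 z) + ψ)))| ≤
      4 * Real.sqrt (5 * (κ₂ ^ 4 * γop ^ 2) / (1 - lam * γop) ^ 2 * (αθ * (1 - γθ)⁻¹ * (βθ * (1 - γθ')⁻¹) / (1 - lamA))) * S ^ 2 := by
  obtain ⟨w₀⟩ := ‹Nonempty κ›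
  haveI : Nonempty ι := ⟨x⟩
  have hl1 : 0 < 1 - lamA := by linarith
  -- Dobrushin's matrix and its Neumann series with the weighted letters
  set Cm : Matrix κ κ ℝ := Matrix.of fun x w => (if w = x then 0 else ∑ u, ∑ v, |A u w| * |A v x| * Hk v u) / (1 - lamA) with hCm
  have hJ : ∀ x w : κ, 0 ≤ (if w = x then (0 : ℝ) else ∑ u, ∑ v, |A u w| * |A v x| * Hk v u) := fun x w => by
    split_ifs
    · exact le_rfl
    · exact whitened_cross_nonneg hHk0 A x w
  have hCmnn : ∀ x w, 0 ≤ Cm x w := fun x w => by rw [hCm, Matrix.of_apply]; exact div_nonneg (hJ x w) hl1.le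
  have hCθ' : ∀ x, ∑ w, Cm x w * θ x w ≤ γθ := fun x => by simp only [hCm, Matrix.of_apply]; exact hCθ x
  have hCθc' : ∀ w, ∑ x, Cm x w * θ x w ≤ γθ' := fun w => by simp only [hCm, Matrix.of_apply]; exact hCθc w
  have hθnn : ∀ x z, 0 ≤ θ x z := fun x z => zero_le_one.trans (hθw1 x z)
  have hγθ0 : 0 ≤ γθ := le_trans (Finset.sum_nonneg fun w _ => mul_nonneg (hCmnn w₀ w) (hθnn w₀ w)) (hCθ' w₀)
  have hγθ'0 : 0 ≤ γθ' := le_trans (Finset.sum_nonneg fun z _ => mul_nonneg (hCmnn z w₀) (hθnn z w₀)) (hCθc' w₀)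
  have hCmrow : ∀ x, ∑ w, Cm x w ≤ γθ := rowsum_le_weighted hCmnn hθw1 hCθ'
  have hD : ∀ x y, 0 ≤ ∑' n : ℕ, (Cm ^ n) x y := neumann_nonneg hCmnn
  have hDC : ∀ x y, (if x = y then (1 : ℝ) else 0) + ∑ w, (∑' n : ℕ, (Cm ^ n) x w) *
      ((if y = w then 0 else ∑ u, ∑ v, |A u y| * |A v w| * Hk v u) / (1 - lamA)) ≤ ∑' n : ℕ, (Cm ^ n) x y := by
    intro x y
    have h := neumann_dominates hCmnn hCmrow hγθ0 hγθ1 x y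
    simp only [hCm, Matrix.of_apply] at h ⊢
    exact h
  have hDr : ∀ z, ∑ w, (∑' n : ℕ, (Cm ^ n) z w) * θ z w ≤ (1 - γθ)⁻¹ := neumann_weighted_rowsum_le hCmnn hθw1 hθdiag hθmul hCθ' hγθ0 hγθ1
  have hDc : ∀ w, ∑ z, (∑' n : ℕ, (Cm ^ n) z w) * θ z w ≤ (1 - γθ')⁻¹ := neumann_weighted_colsum_le hCmnn hθw1 hθdiag hθmul hCθc' hγθ'0 hγθ'1
  have hrow : ∀ x : κ, ∑ w, (if w = x then (0 : ℝ) else ∑ u, ∑ v, |A u w| * |A v x| * Hk v u) / (1 - lamA) ≤ γθ := fun x => by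
    have h := hCmrow x
    simp only [hCm, Matrix.of_apply] at h
    exact h
  -- the constants
  have hdθ : 0 ≤ (1 - γθ)⁻¹ := inv_nonneg.2 (by linarith)
  have hdθ' : 0 ≤ (1 - γθ')⁻¹ := inv_nonneg.2 (by linarith)
  have hαθ : 0 ≤ αθ := le_trans (Finset.sum_nonneg fun w _ => mul_nonneg (whitened_obs_nonneg hHk0 A x w) (hσ0 x w)) (haσ x)
  have hK : 0 ≤ αθ * (1 - γθ)⁻¹ * (βθ * (1 - γθ')⁻¹) / (1 - lamA) := by positivity
  have hm : 0 ≤ 5 * (κ₂ ^ 4 * γop ^ 2) / (1 - lam * γop) ^ 2 := by positivity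
  -- Step 1: the decay of `B(a^v, a^v')` ((466))
  have hB : ∀ v v' : ι, ∑ w, (∑ z', (∑' n : ℕ, (Cm ^ n) z' w) * ∑ u, |A u z'| * Hk v u) * (∑ z', (∑' n : ℕ, (Cm ^ n) z' w) * ∑ u, |A u z'| * Hk v' u) /
      (1 - lamA) ≤ αθ * (1 - γθ)⁻¹ * (βθ * (1 - γθ')⁻¹) / (1 - lamA) / ρ v v' ^ 8 := fun v v' => by
    have h := cross_bilinear_decay (D := fun z w => ∑' n : ℕ, (Cm ^ n) z w) (θ := θ) (σ := σ) (ρ := fun x y => ρ x y ^ 8) (c := fun _ => 1 - lamA)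
      (a := fun w => ∑ u, |A u w| * Hk v u) (b := fun w => ∑ u, |A u w| * Hk v' u) hD hθnn hσ0 hσθ (fun x y w => hρσ x y w)
      (fun x y => one_le_pow₀ (hρ1 x y)) hDr hdθ hDc hdθ' hl1 (fun _ => le_rfl) (fun w => whitened_obs_nonneg hHk0 A v w)
      (fun w => whitened_obs_nonneg hHk0 A v' w) v v' (haσ v) hβ (haσ' v')
    rw [div_mul_eq_div_div] at h
    exact h
  -- Step 2: the raw bound at a distinguished vertex ((467)), with `Σ_w P(Q+R)/c = B + B`
  have hraw := fun v₁ v₂ v₃ => whitened_third_cumulant_raw hΓop Y hUd hU'd hU''c hκ₀ hκ₁ ha hτ hδ hθ0 hθ1 hκθ hκθw hstab hU'b hU''b hlam hUsec hρg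
    hHk hHk0 ψ hlamA hlamA1 hrow hγθ0 hγθ1 hD hDC v₁ v₂ v₃
  have hsplit : ∀ v₁ v₂ v₃ : ι, ∑ w, (∑ z', (∑' n : ℕ, (Cm ^ n) z' w) * ∑ u, |A u z'| * Hk v₁ u) * ((∑ z', (∑' n : ℕ, (Cm ^ n) z' w) * ∑ u, |A u z'| * Hk v₂ u) +
      ∑ z', (∑' n : ℕ, (Cm ^ n) z' w) * ∑ u, |A u z'| * Hk v₃ u) / (1 - lamA) =
      ∑ w, (∑ z', (∑' n : ℕ, (Cm ^ n) z' w) * ∑ u, |A u z'| * Hk v₁ u) * (∑ z', (∑' n : ℕ, (Cm ^ n) z' w) * ∑ u, |A u z'| * Hk v₂ u) / (1 - lamA) +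
      ∑ w, (∑ z', (∑' n : ℕ, (Cm ^ n) z' w) * ∑ u, |A u z'| * Hk v₁ u) * (∑ z', (∑' n : ℕ, (Cm ^ n) z' w) * ∑ u, |A u z'| * Hk v₃ u) / (1 - lamA) :=
    fun v₁ v₂ v₃ => by
      rw [← Finset.sum_add_distrib]
      exact Finset.sum_congr rfl fun w _ => by ring
  -- Step 3: the distinguished bounds ((463) `distinguished_bound`)
  have hdist : ∀ v₁ v₂ v₃ : ι, |∫ w, (U' (matrixCLM A (WithLp.toLp 2 w) + ψ) (EuclideanSpace.single v₁ (1 : ℝ)) -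
            ∫ w', U' (matrixCLM A (WithLp.toLp 2 w') + ψ) (EuclideanSpace.single v₁ (1 : ℝ))
              ∂((volume : Measure (κ → ℝ)).tilted fun z => -(1 / 2 * (z ⬝ᵥ z) + U (matrixCLM A (WithLp.toLp 2 z) + ψ)))) *
          (U' (matrixCLM A (WithLp.toLp 2 w) + ψ) (EuclideanSpace.single v₂ (1 : ℝ)) -
            ∫ w', U' (matrixCLM A (WithLp.toLp 2 w') + ψ) (EuclideanSpace.single v₂ (1 : ℝ))
              ∂((volume : Measure (κ → ℝ)).tilted fun z => -(1 / 2 * (z ⬝ᵥ z) + U (matrixCLM A (WithLp.toLp 2 z) + ψ)))) *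
          (U' (matrixCLM A (WithLp.toLp 2 w) + ψ) (EuclideanSpace.single v₃ (1 : ℝ)) -
            ∫ w', U' (matrixCLM A (WithLp.toLp 2 w') + ψ) (EuclideanSpace.single v₃ (1 : ℝ))
              ∂((volume : Measure (κ → ℝ)).tilted fun z => -(1 / 2 * (z ⬝ᵥ z) + U (matrixCLM A (WithLp.toLp 2 z) + ψ))))
        ∂((volume : Measure (κ → ℝ)).tilted fun z => -(1 / 2 * (z ⬝ᵥ z) + U (matrixCLM A (WithLp.toLp 2 z) + ψ)))| ≤
      4 * Real.sqrt (5 * (κ₂ ^ 4 * γop ^ 2) / (1 - lam * γop) ^ 2 * (αθ * (1 - γθ)⁻¹ * (βθ * (1 - γθ')⁻¹) / (1 - lamA))) /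
        (min (ρ v₁ v₂) (ρ v₁ v₃)) ^ 4 := fun v₁ v₂ v₃ => by
    refine distinguished_bound hm hK (hρ1 v₁ v₂) (hρ1 v₁ v₃) (hB v₁ v₂) (hB v₁ v₃) ?_
    have h := hraw v₁ v₂ v₃
    rw [hsplit] at h
    have e : 2 * ((∑ w, (∑ z', (∑' n : ℕ, (Cm ^ n) z' w) * ∑ u, |A u z'| * Hk v₁ u) * (∑ z', (∑' n : ℕ, (Cm ^ n) z' w) * ∑ u, |A u z'| * Hk v₂ u) /
        (1 - lamA)) + ∑ w, (∑ z', (∑' n : ℕ, (Cm ^ n) z' w) * ∑ u, |A u z'| * Hk v₁ u) * (∑ z', (∑' n : ℕ, (Cm ^ n) z' w) * ∑ u, |A u z'| * Hk v₃ u) /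
        (1 - lamA)) * (5 * (κ₂ ^ 4 * γop ^ 2) / (1 - lam * γop) ^ 2) =
        2 * (5 * (κ₂ ^ 4 * γop ^ 2) / (1 - lam * γop) ^ 2) * ((∑ w, (∑ z', (∑' n : ℕ, (Cm ^ n) z' w) * ∑ u, |A u z'| * Hk v₁ u) *
          (∑ z', (∑' n : ℕ, (Cm ^ n) z' w) * ∑ u, |A u z'| * Hk v₂ u) / (1 - lamA) + ∑ w, (∑ z', (∑' n : ℕ, (Cm ^ n) z' w) * ∑ u, |A u z'| * Hk v₁ u) *
          (∑ z', (∑' n : ℕ, (Cm ^ n) z' w) * ∑ u, |A u z'| * Hk v₃ u) / (1 - lamA))) := by ring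
    rw [e] at h
    exact h
  -- Step 4: the tree sum ((463) `third_kernel_letter`) with the three vertex choices (integrands commuted)
  refine third_kernel_letter (ρ := ρ) (m := 5 * (κ₂ ^ 4 * γop ^ 2) / (1 - lam * γop) ^ 2)
    (K := αθ * (1 - γθ)⁻¹ * (βθ * (1 - γθ')⁻¹) / (1 - lamA)) hρ1 hρsymm hρmul x hS (fun y z => hdist x y z) (fun y z => ?_) (fun y z => ?_)
  · -- `y` distinguished: commute the first two factors, `ρ y x = ρ x y`
    have h := hdist y x z
    rw [hρsymm y x] at h
    refine le_trans (le_of_eq ?_) h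
    congr 1
    exact integral_congr_ae (ae_of_all _ fun w => by ring)
  · -- `z` distinguished: `ρ z x = ρ x z`, `ρ z y = ρ y z`
    have h := hdist z x y
    rw [hρsymm z x, hρsymm z y] at h
    refine le_trans (le_of_eq ?_) h
    congr 1
    exact integral_congr_ae (ae_of_all _ fun w => by ring)

end Summit.QuantumFields.BalabanUV.T4Continuum.NE7b.SupWhitenedThirdCumulantKernelLetter

end
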